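import Literature.Geometry.Lorentzian.ChartCalculus
import Literature.Geometry.Lorentzian.CoordCurvature
import Literature.Geometry.Lorentzian.KerrIngoingCoordMetric
import HarnessLib

/-!
# The Kerr metric in ingoing Kerr coordinates `(t*, r, μ, φ)`, III: second derivatives and the
# Koszul form

Infrastructure (all results proved) for `Kerr.isRicciFlat M a r₀` (all spins). Continuing
`KerrIngoingCoordMetric.lean`: the second partial derivatives of the five coefficient functions of
the component field `Kerr.Ingoing.bilin` in closed form (`∂²_{rr}`, `∂²_{rμ}`, `∂²_{μμ}`; fields
`bilinRR`, `bilinRM`, `bilinMM` with `hasFDerivAt_bilinR`, `hasFDerivAt_bilinM`), the Koszul form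
`K(Y; X, Z) = ∂_X g(Y, Z) + ∂_Y g(Z, X) − ∂_Z g(X, Y)` of the components (`koszulForm`,
`ChartCalculus.lean`; twice the Christoffel symbols of the first kind, O'Neill 1983, Ch. 3,
Prop. 3.13) in closed form (`Kerr.Ingoing.koszulForm_bilin`), and its first derivatives
(`Kerr.Ingoing.fderiv_koszulForm_bilin`) — the two ingredients of the coordinate formula for the
Ricci tensor (`OpensChart.ricci_eq_coord`). Everything holds on the regular set `{Σ ≠ 0, μ² ≠ 1}`.

## References

* B. O'Neill, *Semi-Riemannian geometry* (1983), Ch. 3, Prop. 3.13, Lemma 3.38.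
* R. P. Kerr, Phys. Rev. Lett. 11 (1963) 237–238; M. Visser, arXiv:0706.0622, (E:K1).
-/

noncomputable section

set_option maxSynthPendingDepth 3

open Set Function Filter
open scoped Topology

namespace Literature.Geometry.Lorentzian

namespace Kerr

namespace Ingoing

/-! ### The regular set -/

/-- The regular set `{Σ ≠ 0, 1 − μ² ≠ 0}` of the coordinate expressions (it contains the coordinate
domain `{r > 0, −1 < μ < 1}`). [folklore] -/
def regularSet (a : ℝ) : Set E4 := {u | sigma a u ≠ 0 ∧ sinSq u ≠ 0}

/-- The regular set is open. [folklore] -/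
theorem isOpen_regularSet (a : ℝ) : IsOpen (regularSet a) := by
  have h1 : Continuous (sigma a) := by unfold sigma; fun_prop
  have h2 : Continuous sinSq := by unfold sinSq; fun_prop
  exact (isOpen_ne_fun h1 continuous_const).inter (isOpen_ne_fun h2 continuous_const)

section Deriv

variable (M a : ℝ) {u : E4}

/-! ### Second partial derivatives of the atoms -/

/-- `∂²_{rr} H = 2Mr(r² − 3a²μ²)/Σ³`. [folklore] -/
def scalarHrr (M a : ℝ) (u : E4) : ℝ := 2 * M * u 1 * (u 1 ^ 2 - 3 * a ^ 2 * u 2 ^ 2) / sigma a u ^ 3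

/-- `∂²_{rμ} H = 2Ma²μ(3r² − a²μ²)/Σ³`. [folklore] -/
def scalarHrm (M a : ℝ) (u : E4) : ℝ := 2 * M * a ^ 2 * u 2 * (3 * u 1 ^ 2 - a ^ 2 * u 2 ^ 2) / sigma a u ^ 3

/-- `∂²_{μμ} H = −2Ma²r(r² − 3a²μ²)/Σ³`. [folklore] -/
def scalarHmm (M a : ℝ) (u : E4) : ℝ := -(2 * M * a ^ 2 * u 1 * (u 1 ^ 2 - 3 * a ^ 2 * u 2 ^ 2)) / sigma a u ^ 3

/-- `∂(∂_r H) = H_{rr} dr + H_{rμ} dμ`. [folklore] -/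
theorem hasGrad_scalarHr (hS : sigma a u ≠ 0) :
    HasGrad (scalarHr M a) u (scalarHrr M a u) (scalarHrm M a u) := by
  have hf := (((HasGrad.snd u).sq.const_mul (a ^ 2)).sub (HasGrad.fst u).sq).const_mul M
  have h := hf.div (hasGrad_sigma a u).sq (pow_ne_zero 2 hS)
  refine h.congr ?_ ?_
  · simp only [scalarHrr, sigma] at hS ⊢
    field_simp
    ring
  · simp only [scalarHrm, sigma] at hS ⊢
    field_simp
    ring

/-- `∂(∂_μ H) = H_{rμ} dr + H_{μμ} dμ`. [folklore] -/
theorem hasGrad_scalarHm (hS : sigma a u ≠ 0) :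
    HasGrad (scalarHm M a) u (scalarHrm M a u) (scalarHmm M a u) := by
  have hf := ((((HasGrad.fst u).const_mul (2 * M * a ^ 2)).mul (HasGrad.snd u))).neg
  have h := hf.div (hasGrad_sigma a u).sq (pow_ne_zero 2 hS)
  refine h.congr ?_ ?_
  · simp only [scalarHrm, sigma] at hS ⊢
    field_simp
    ring
  · simp only [scalarHmm, sigma] at hS ⊢
    field_simp
    ring

/-- `∂²_{rr} c₂₂ = 2/(1 − μ²)`. [folklore] -/
def c22rr (u : E4) : ℝ := 2 / sinSq u

/-- `∂²_{rμ} c₂₂ = 4rμ/(1 − μ²)²`. [folklore] -/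
def c22rm (u : E4) : ℝ := 4 * u 1 * u 2 / sinSq u ^ 2

/-- `∂²_{μμ} c₂₂ = 2(r² + a²)(1 + 3μ²)/(1 − μ²)³`. [folklore] -/
def c22mm (a : ℝ) (u : E4) : ℝ := 2 * (u 1 ^ 2 + a ^ 2) * (1 + 3 * u 2 ^ 2) / sinSq u ^ 3

/-- `∂(∂_r c₂₂)`. [folklore] -/
theorem hasGrad_c22r (hP : sinSq u ≠ 0) : HasGrad c22r u (c22rr u) (c22rm u) := by
  have h := ((HasGrad.fst u).const_mul 2).div (hasGrad_sinSq u) hP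
  refine h.congr ?_ ?_
  · simp only [c22rr, mul_one, mul_zero, sub_zero]
    field_simp
  · simp only [c22rm, sinSq] at hP ⊢
    field_simp
    ring

/-- `∂(∂_μ c₂₂)`. [folklore] -/
theorem hasGrad_c22m (hP : sinSq u ≠ 0) : HasGrad (c22m a) u (c22rm u) (c22mm a u) := by
  have hf := ((HasGrad.snd u).const_mul 2).mul (((HasGrad.fst u).sq).add (HasGrad.const u (a ^ 2)))
  have h := hf.div (hasGrad_sinSq u).sq (pow_ne_zero 2 hP)
  refine h.congr ?_ ?_
  · simp only [c22rm, sinSq] at hP ⊢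
    field_simp
    ring
  · simp only [c22mm, sinSq] at hP ⊢
    field_simp
    ring

/-- `∂²_{rr} h₀₀ = 2H_{rr}`. [folklore] -/
def h00rr (M a : ℝ) (u : E4) : ℝ := 2 * scalarHrr M a u

/-- `∂²_{rμ} h₀₀ = 2H_{rμ}`. [folklore] -/
def h00rm (M a : ℝ) (u : E4) : ℝ := 2 * scalarHrm M a u

/-- `∂²_{μμ} h₀₀ = 2H_{μμ}`. [folklore] -/
def h00mm (M a : ℝ) (u : E4) : ℝ := 2 * scalarHmm M a u

/-- `∂(∂_r h₀₀)`. [folklore] -/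
theorem hasGrad_h00r (hS : sigma a u ≠ 0) : HasGrad (h00r M a) u (h00rr M a u) (h00rm M a u) :=
  (hasGrad_scalarHr M a hS).const_mul 2

/-- `∂(∂_μ h₀₀)`. [folklore] -/
theorem hasGrad_h00m (hS : sigma a u ≠ 0) : HasGrad (h00m M a) u (h00rm M a u) (h00mm M a u) :=
  (hasGrad_scalarHm M a hS).const_mul 2

/-- `∂²_{rr} h₀₃`. [folklore] -/
def h03rr (M a : ℝ) (u : E4) : ℝ := -(a * sinSq u) * h00rr M a u

/-- `∂²_{rμ} h₀₃`. [folklore] -/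
def h03rm (M a : ℝ) (u : E4) : ℝ := 2 * a * u 2 * h00r M a u + -(a * sinSq u) * h00rm M a u

/-- `∂²_{μμ} h₀₃`. [folklore] -/
def h03mm (M a : ℝ) (u : E4) : ℝ :=
  2 * a * h00 M a u + 4 * a * u 2 * h00m M a u + -(a * sinSq u) * h00mm M a u

/-- `∂(∂_r h₀₃)`. [folklore] -/
theorem hasGrad_h03r (hS : sigma a u ≠ 0) : HasGrad (h03r M a) u (h03rr M a u) (h03rm M a u) := by
  have h := (hasGrad_c13 a u).mul (hasGrad_h00r M a hS)
  refine h.congr ?_ ?_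
  · simp only [h03rr, c13]; ring
  · simp only [h03rm, c13]

/-- `∂(∂_μ h₀₃)`. [folklore] -/
theorem hasGrad_h03m (hS : sigma a u ≠ 0) : HasGrad (h03m M a) u (h03rm M a u) (h03mm M a u) := by
  have h1 := (((HasGrad.snd u).const_mul (2 * a))).mul (hasGrad_h00 M a hS)
  have h2 := (hasGrad_c13 a u).mul (hasGrad_h00m M a hS)
  have h := h1.add h2
  have he : (fun u : E4 ↦ 2 * a * u 2 * h00 M a u + c13 a u * h00m M a u) = h03m M a := by
    funext u; simp only [h03m, c13]
  rw [he] at h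
  refine h.congr ?_ ?_
  · simp only [h03rm, c13]; ring
  · simp only [h03mm, c13]; ring

/-- `∂²_{rr} c₃₃`. [folklore] -/
def c33rr (M a : ℝ) (u : E4) : ℝ := 2 * sinSq u + a ^ 2 * sinSq u ^ 2 * h00rr M a u

/-- `∂²_{rμ} c₃₃`. [folklore] -/
def c33rm (M a : ℝ) (u : E4) : ℝ :=
  -(4 * u 1 * u 2) + -(4 * a ^ 2 * u 2 * sinSq u) * h00r M a u + a ^ 2 * sinSq u ^ 2 * h00rm M a u

/-- `∂²_{μμ} c₃₃`. [folklore] -/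
def c33mm (M a : ℝ) (u : E4) : ℝ :=
  -(2 * (u 1 ^ 2 + a ^ 2)) + -(4 * a ^ 2 * (sinSq u - 2 * u 2 ^ 2)) * h00 M a u +
    -(8 * a ^ 2 * u 2 * sinSq u) * h00m M a u + a ^ 2 * sinSq u ^ 2 * h00mm M a u

/-- `∂(∂_r c₃₃)`. [folklore] -/
theorem hasGrad_c33r (hS : sigma a u ≠ 0) : HasGrad (c33r M a) u (c33rr M a u) (c33rm M a u) := by
  have h1 := (((HasGrad.fst u).const_mul 2)).mul (hasGrad_sinSq u)
  have h2 := (((hasGrad_sinSq u).sq).const_mul (a ^ 2)).mul (hasGrad_h00r M a hS)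
  have h := h1.add h2
  refine h.congr ?_ ?_
  · simp only [c33rr]; ring
  · simp only [c33rm]; ring

/-- `∂(∂_μ c₃₃)`. [folklore] -/
theorem hasGrad_c33m (hS : sigma a u ≠ 0) : HasGrad (c33m M a) u (c33rm M a u) (c33mm M a u) := by
  have h1 := ((((HasGrad.snd u).const_mul 2)).mul
    (((HasGrad.fst u).sq).add (HasGrad.const u (a ^ 2)))).neg
  have h2 := ((((HasGrad.snd u).mul (hasGrad_sinSq u)).const_mul (4 * a ^ 2)).neg).mul
    (hasGrad_h00 M a hS)
  have h3 := (((hasGrad_sinSq u).sq).const_mul (a ^ 2)).mul (hasGrad_h00m M a hS)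
  have h := (h1.add h2).add h3
  have he : (fun u : E4 ↦ -(2 * u 2 * (u 1 ^ 2 + a ^ 2)) + -(4 * a ^ 2 * (u 2 * sinSq u)) * h00 M a u +
      a ^ 2 * sinSq u ^ 2 * h00m M a u) = c33m M a := by
    funext u; simp only [c33m]; ring
  rw [he] at h
  refine h.congr ?_ ?_
  · simp only [c33rm]; ring
  · simp only [c33mm]; ring

/-! ### The second derivatives of the component field -/

/-- **`∂²_{rr} g`** in closed form. [folklore] -/
def bilinRR (M a : ℝ) (u : E4) : E4 →L[ℝ] E4 →L[ℝ] ℝ :=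
  c22rr u • B22 + c33rr M a u • B33 + h00rr M a u • L00 + h03rr M a u • L03

/-- **`∂²_{rμ} g`** in closed form. [folklore] -/
def bilinRM (M a : ℝ) (u : E4) : E4 →L[ℝ] E4 →L[ℝ] ℝ :=
  c22rm u • B22 + c33rm M a u • B33 + h00rm M a u • L00 + h03rm M a u • L03

/-- **`∂²_{μμ} g`** in closed form. [folklore] -/
def bilinMM (M a : ℝ) (u : E4) : E4 →L[ℝ] E4 →L[ℝ] ℝ :=
  (2 * a) • B13 + c22mm a u • B22 + c33mm M a u • B33 + h00mm M a u • L00 + h03mm M a u • L03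

/-- `∂(∂_r g) = ∂²_{rr} g dr + ∂²_{rμ} g dμ`. [folklore] -/
theorem hasFDerivAt_bilinR (hS : sigma a u ≠ 0) (hP : sinSq u ≠ 0) :
    HasFDerivAt (bilinR M a)
      ((E4.dx 1).smulRight (bilinRR M a u) + (E4.dx 2).smulRight (bilinRM M a u)) u := by
  have h := ((((hasGrad_c22r hP).smul_const B22).add ((hasGrad_c33r M a hS).smul_const B33)).add
    ((hasGrad_h00r M a hS).smul_const L00)).add ((hasGrad_h03r M a hS).smul_const L03)
  refine h.congr_fderiv ?_
  ext V v w
  simp only [bilinRR, bilinRM, ContinuousLinearMap.smulRight_apply, add_apply,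
    smul_apply, smul_eq_mul]
  ring

/-- `∂(∂_μ g) = ∂²_{rμ} g dr + ∂²_{μμ} g dμ`. [folklore] -/
theorem hasFDerivAt_bilinM (hS : sigma a u ≠ 0) (hP : sinSq u ≠ 0) :
    HasFDerivAt (bilinM M a)
      ((E4.dx 1).smulRight (bilinRM M a u) + (E4.dx 2).smulRight (bilinMM M a u)) u := by
  have h0 : HasGrad (fun u : E4 ↦ 2 * a * u 2) u 0 (2 * a) := by
    have h := (HasGrad.snd u).const_mul (2 * a)
    refine h.congr ?_ ?_ <;> ring
  have h := ((((h0.smul_const B13).add ((hasGrad_c22m a hP).smul_const B22)).add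
    ((hasGrad_c33m M a hS).smul_const B33)).add ((hasGrad_h00m M a hS).smul_const L00)).add
    ((hasGrad_h03m M a hS).smul_const L03)
  refine h.congr_fderiv ?_
  ext V v w
  simp only [bilinRM, bilinMM, ContinuousLinearMap.smulRight_apply, add_apply,
    smul_apply, smul_eq_mul, zero_smul, smul_zero, zero_add]
  ring

/-- `(∂²_{rr} g)(v, w)` evaluated. [folklore] -/
theorem bilinRR_apply (u v w : E4) :
    bilinRR M a u v w = c22rr u * (v 2 * w 2) + c33rr M a u * (v 3 * w 3) +
      h00rr M a u * ((v 0 + v 1) * (w 0 + w 1)) + h03rr M a u * ((v 0 + v 1) * w 3 + v 3 * (w 0 + w 1)) := by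
  simp only [bilinRR, B22, B33, L00, L03, add_apply,
    smul_apply, E4.tmul_apply, ell0_apply, smul_eq_mul, E4.dx, PiLp.proj_apply]

/-- `(∂²_{rμ} g)(v, w)` evaluated. [folklore] -/
theorem bilinRM_apply (u v w : E4) :
    bilinRM M a u v w = c22rm u * (v 2 * w 2) + c33rm M a u * (v 3 * w 3) +
      h00rm M a u * ((v 0 + v 1) * (w 0 + w 1)) + h03rm M a u * ((v 0 + v 1) * w 3 + v 3 * (w 0 + w 1)) := by
  simp only [bilinRM, B22, B33, L00, L03, add_apply,
    smul_apply, E4.tmul_apply, ell0_apply, smul_eq_mul, E4.dx, PiLp.proj_apply]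

/-- `(∂²_{μμ} g)(v, w)` evaluated. [folklore] -/
theorem bilinMM_apply (u v w : E4) :
    bilinMM M a u v w = 2 * a * (v 1 * w 3 + v 3 * w 1) + c22mm a u * (v 2 * w 2) +
      c33mm M a u * (v 3 * w 3) + h00mm M a u * ((v 0 + v 1) * (w 0 + w 1)) +
      h03mm M a u * ((v 0 + v 1) * w 3 + v 3 * (w 0 + w 1)) := by
  simp only [bilinMM, B13, B22, B33, L00, L03, add_apply,
    smul_apply, E4.tmul_apply, ell0_apply, smul_eq_mul, E4.dx, PiLp.proj_apply]

/-! ### The Koszul form of the components and its derivative -/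

/-- **The Koszul form of the Kerr components in closed form**: on the regular set,
`K(Y; X, Z) = ∂_X g(Y,Z) + ∂_Y g(Z,X) − ∂_Z g(X,Y)` with `∂_V g = V¹ ∂_r g + V² ∂_μ g`
(O'Neill 1983, Ch. 3, Prop. 3.13: twice the Christoffel symbols of the first kind).
[cite: ONeill1983, Ch. 3, Prop. 3.13] -/
theorem koszulForm_bilin (hu : u ∈ regularSet a) (Y X Z : E4) :
    OpensChart.koszulForm (bilin M a) u Y X Z =
      (X 1 * bilinR M a u Y Z + X 2 * bilinM M a u Y Z) +
        (Y 1 * bilinR M a u Z X + Y 2 * bilinM M a u Z X) -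
        (Z 1 * bilinR M a u X Y + Z 2 * bilinM M a u X Y) := by
  rw [OpensChart.koszulForm_apply, fderiv_bilin_apply M a hu.1 hu.2, fderiv_bilin_apply M a hu.1 hu.2,
    fderiv_bilin_apply M a hu.1 hu.2]

/-- The scalar `y ↦ F y v w` of a form-valued `F` with `DF(u)(V) = V¹ A + V² B` has gradient
`(A(v,w), B(v,w))`. [folklore] -/
theorem hasGrad_apply₂ {F : E4 → E4 →L[ℝ] E4 →L[ℝ] ℝ} {A B : E4 →L[ℝ] E4 →L[ℝ] ℝ}
    (hF : HasFDerivAt F ((E4.dx 1).smulRight A + (E4.dx 2).smulRight B) u) (v w : E4) :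
    HasGrad (fun y ↦ F y v w) u (A v w) (B v w) := by
  have h1 := MetricCoord.hasFDerivAt_clm_apply_const hF v
  have h2 := MetricCoord.hasFDerivAt_clm_apply_const h1 w
  refine h2.congr_fderiv ?_
  ext V
  simp only [ContinuousLinearMap.flip_apply, add_apply,
    ContinuousLinearMap.smulRight_apply, smul_apply, smul_eq_mul]
  ring

/-- **The derivative of `∂_X g(Y, Z)`**: on the regular set,
`∂(∂_X g(Y,Z)) = (X¹ g_{rr} + X² g_{rμ})(Y,Z) dr + (X¹ g_{rμ} + X² g_{μμ})(Y,Z) dμ`. [folklore] -/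
theorem hasGrad_fderiv_bilin (hu : u ∈ regularSet a) (X Y Z : E4) :
    HasGrad (fun y ↦ fderiv ℝ (bilin M a) y X Y Z) u
      (X 1 * bilinRR M a u Y Z + X 2 * bilinRM M a u Y Z)
      (X 1 * bilinRM M a u Y Z + X 2 * bilinMM M a u Y Z) := by
  have hev : (fun y ↦ fderiv ℝ (bilin M a) y X Y Z) =ᶠ[𝓝 u]
      fun y ↦ X 1 * bilinR M a y Y Z + X 2 * bilinM M a y Y Z :=
    Filter.eventually_of_mem ((isOpen_regularSet a).mem_nhds hu) fun y hy ↦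
      fderiv_bilin_apply M a hy.1 hy.2 X Y Z
  have hR := hasGrad_apply₂ (hasFDerivAt_bilinR M a hu.1 hu.2) Y Z
  have hMu := hasGrad_apply₂ (hasFDerivAt_bilinM M a hu.1 hu.2) Y Z
  have h := (hR.const_mul (X 1)).add (hMu.const_mul (X 2))
  exact HasFDerivAt.congr_of_eventuallyEq h hev

/-- `∂_r` of the Koszul form `K(Y; X, Z)`, in closed form. [folklore] -/
def dKoszulR (M a : ℝ) (u Y X Z : E4) : ℝ :=
  (X 1 * bilinRR M a u Y Z + X 2 * bilinRM M a u Y Z) +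
    (Y 1 * bilinRR M a u Z X + Y 2 * bilinRM M a u Z X) -
    (Z 1 * bilinRR M a u X Y + Z 2 * bilinRM M a u X Y)

/-- `∂_μ` of the Koszul form `K(Y; X, Z)`, in closed form. [folklore] -/
def dKoszulM (M a : ℝ) (u Y X Z : E4) : ℝ :=
  (X 1 * bilinRM M a u Y Z + X 2 * bilinMM M a u Y Z) +
    (Y 1 * bilinRM M a u Z X + Y 2 * bilinMM M a u Z X) -
    (Z 1 * bilinRM M a u X Y + Z 2 * bilinMM M a u X Y)

/-- **The derivative of the Koszul form**: on the regular set,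
`∂K(Y; X, Z) = ∂_r K dr + ∂_μ K dμ` with the closed forms `dKoszulR`, `dKoszulM`
(O'Neill 1983, Ch. 3, Lemma 3.38: the `∂Γ` terms of the curvature). [cite: ONeill1983, Ch. 3, Lemma 3.38] -/
theorem hasGrad_koszulForm (hu : u ∈ regularSet a) (Y X Z : E4) :
    HasGrad (fun y ↦ OpensChart.koszulForm (bilin M a) y Y X Z) u (dKoszulR M a u Y X Z) (dKoszulM M a u Y X Z) := by
  have h := ((hasGrad_fderiv_bilin M a hu X Y Z).add (hasGrad_fderiv_bilin M a hu Y Z X)).sub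
    (hasGrad_fderiv_bilin M a hu Z X Y)
  have he : (fun y ↦ fderiv ℝ (bilin M a) y X Y Z + fderiv ℝ (bilin M a) y Y Z X -
      fderiv ℝ (bilin M a) y Z X Y) = fun y ↦ OpensChart.koszulForm (bilin M a) y Y X Z := by
    funext y; rw [OpensChart.koszulForm_apply]
  rw [he] at h
  exact h

/-- **`∂_V K(Y; X, Z) = V¹ ∂_r K + V² ∂_μ K`** on the regular set. [cite: ONeill1983, Ch. 3, Lemma 3.38] -/
theorem fderiv_koszulForm_bilin (hu : u ∈ regularSet a) (Y X Z V : E4) :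
    fderiv ℝ (fun y ↦ OpensChart.koszulForm (bilin M a) y Y X Z) u V =
      dKoszulR M a u Y X Z * V 1 + dKoszulM M a u Y X Z * V 2 :=
  (hasGrad_koszulForm M a hu Y X Z).fderiv_apply V

end Deriv

end Ingoing

end Kerr

end Literature.Geometry.Lorentzian

end
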